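import Summits.BirchSwinnertonDyer.BirchSwinnertonDyer.Theorems.GenusKolyvaginAtTwoEquivariantKolyvaginExactAtTwoQuadInfResTwist
import Literature.NumberTheory.EllipticCurves.HeegnerPoints
import HarnessLib

/-!
# Route `GenusKolyvaginAtTwo`, LINE 6, KEY crux Q3 `EquivariantKolyvaginExactAtTwo`
# (stmt-BirchSwinnertonDyer-24882): THE SELMER-LEVEL `±` COMPARISON, SHARPENED —
# `Φ : Sel_{p^∞}(E/ℚ) × Sel_{p^∞}(E^{(c)}/ℚ) → Sel_{p^∞}(E/K)` has kernel killed by `2` (embedded in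
# either factor) and cokernel killed by `4`, for `K` imaginary quadratic with `E(K)[p] = 0` (PROVED)

Helper (seat `bsd-line-gk2-p3` g10, cell `bsd-f1-sign2`; `--supports` the item, closes nothing):
sequel to `…QuadInfResTwist` (this seat, p613926: the `H¹`-level eigen description). The tree's
`BSDSelmerParityDokchitserBaseChangeProofs` builds the comparison map
`comparisonMap : Sel_{p^∞}(E/ℚ) × Sel_{p^∞}(E^{(c)}/ℚ) → Sel_{p^∞}(E/K)`, `(η, η') ↦ res η + hPsiK (res η')`,
for ANY quadratic `K = ℚ(θ)`, `θ² = c`, with kernel killed by `8` (`nsmul_eq_zero_of_comparisonMap_eq_zero`)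
and cokernel killed by `8` (`nsmul_mem_range_comparisonMap`) — enough for coranks. For the ORDER
bookkeeping of the Q3 architecture (stub S8 of the kernel-status memo, evidence #9: the `2`-adic
dictionary `Ш(E/K)[2^∞]` vs `Ш(E/ℚ)[2^∞]·Ш(E^K/ℚ)[2^∞]`) the exponents matter; on the habitat they drop:

* §4 `selmerGroupPInfty_eq_finSelmerGroupPInfty_of_isTotallyComplex` — over a totally complex field
  the archimedean `p^∞`-Selmer conditions are vacuous (`K_w ≅ ℂ`).
* §5 (`K` imaginary quadratic) `conjH1Primary_mem_selmerGroupPInfty` — `Sel_{p^∞}(E/K)` is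
  `Gal(K/ℚ)`-stable (finite conditions permuted, `conjH1Primary_mem_finSelmerGroupPInfty`; no
  archimedean ones); `coe_comparisonMap_apply` (definitional unfolding); and, under `E(K)[p] = 0`:
  **`two_nsmul_eq_zero_of_comparisonMap_eq_zero_of_noTorsion`** (`Φ x = 0 ⟹ 2x = 0`),
  **`eq_of_comparisonMap_eq_zero_of_fst_eq`** (`ker Φ ↪ Sel_{p^∞}(E/ℚ)`: kernel elements with equal
  first component coincide), **`four_nsmul_mem_range_comparisonMap_of_noTorsion`** (`4·Sel_{p^∞}(E/K)
  ⊆ im Φ`: `s ± τs` come from `E`, `E^{(c)}` by p613926, lie in `Sel(E/K)` by `τ`-stability, and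
  `two_nsmul_mem_selmerGroupPInfty_of_res_mem` brings `2η`, `2η'` into the `ℚ`-Selmer groups);
  `comparisonMap_two_sharp_of_habitat` — all three at `p = 2` from `ρ̄_{E,2}` onto (items' binder).

The residual exponent `4 = 2 · 2` is (eigen splitting: the `±` images meet in the `τ`-fixed
`2`-torsion) × (local degree `2` at the primes of `ℚ` that do not split in `K`: the Kramer / DEF
primes of the line); making it exact is stub S8. Everything is PROVED from tree theorems (no named
fact, no definition, no `sorry`, standard axioms). BSD is not proved by any of this.

References: [DokchitserDokchitserAnnals2010] Lemma 4.14 (proof); [Dokchitser2013ParityNotes] §4;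
[Kramer1981] (the exact `2`-adic correction, not formalised here); [GrossLMS1991] §6.
-/

set_option autoImplicit false
set_option linter.dupNamespace false -- tree convention: `Summit.BirchSwinnertonDyer.BirchSwinnertonDyer.Theorems` (summit = sub-problem)

noncomputable section

open scoped Classical

namespace Summit.BirchSwinnertonDyer.BirchSwinnertonDyer.Theorems.GenusExact.QuadInfResTwist

open WeierstrassCurve NumberField Literature.NumberTheory.EllipticCurves

/-! ## §4 Over a totally complex field the archimedean `p^∞`-Selmer conditions are vacuous -/

section TotallyComplex

variable {K : Type} [Field K] [NumberField K] [IsTotallyComplex K] (X : WeierstrassCurve K) (p : ℕ)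

/-- **`Sel_{p^∞}(X/K) = finSel_{p^∞}(X/K)` for `K` totally complex**: at a complex place `w`,
`K_w ≅ ℂ` is algebraically closed, `H¹(K_w, ·) = 0` and the local condition is `⊤`
(`localRestrictionKer_eq_top_of_isAlgClosed`). [cite: GrossLMS1991, §6 (proof of Prop. 6.2 (1))] -/
theorem selmerGroupPInfty_eq_finSelmerGroupPInfty_of_isTotallyComplex :
    selmerGroupPInfty X p = X.finSelmerGroupPInfty p := by
  rw [X.selmerGroupPInfty_eq_finSelmerGroupPInfty_inf p]
  refine le_antisymm inf_le_left (le_inf le_rfl ?_)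
  refine le_iInf fun w ↦ ?_
  haveI : IsAlgClosed w.Completion :=
    isAlgClosed_of_ringEquiv
      (InfinitePlace.Completion.ringEquivComplexOfIsComplex (IsTotallyComplex.isComplex w)).symm
  rw [selmerLocalKerPrimary_eq_comap, localRestrictionKer_eq_top_of_isAlgClosed, AddSubgroup.comap_top]
  exact le_top

end TotallyComplex

/-! ## §5 `K` imaginary quadratic: `τ`-stability of `Sel_{p^∞}(E/K)` and the SHARP comparison -/

section ImaginaryQuadratic

variable (W : WeierstrassCurve ℚ) (K : Type) [Field K] [NumberField K] (hK : IsImaginaryQuadratic K)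
  {θ : K} {c : ℚ} (hθ : θ ∉ Set.range (algebraMap ℚ K)) (hc : θ ^ 2 = algebraMap ℚ K c) (p : ℕ)

include hK in
/-- **`Sel_{p^∞}(E/K)` is stable under `Gal(K/ℚ)`** for `K` imaginary quadratic: the finite
conditions are permuted (`conjH1Primary_mem_finSelmerGroupPInfty`) and there are no archimedean
ones (§4). [cite: DokchitserDokchitserAnnals2010, Lemma 4.14] -/
theorem conjH1Primary_mem_selmerGroupPInfty (σ : K ≃ₐ[ℚ] K)
    {s : galH1Primary (W.baseChange K) p} (hs : s ∈ selmerGroupPInfty (W.baseChange K) p) :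
    (isLiftOfAut_liftAut σ).conjH1Primary W p s ∈ selmerGroupPInfty (W.baseChange K) p := by
  haveI : IsTotallyComplex K := hK.2
  rw [selmerGroupPInfty_eq_finSelmerGroupPInfty_of_isTotallyComplex] at hs ⊢
  exact conjH1Primary_mem_finSelmerGroupPInfty W p (isLiftOfAut_liftAut σ) hs

/-- The comparison map on underlying classes: `Φ(η, η') = res η + hPsiK (res η')` (definitional).
[cite: DokchitserDokchitserAnnals2010, Lemma 4.14 (proof)] -/
theorem coe_comparisonMap_apply (x : selmerGroupPInfty W p × selmerGroupPInfty (W.quadraticTwist c) p) :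
    ((comparisonMap W K hθ hc p x : selmerGroupPInfty (W.baseChange K) p) :
        galH1Primary (W.baseChange K) p) =
      resPrimary W K p (x.1 : galH1Primary W p) +
        hPsiK W K hθ hc p (resPrimary (W.quadraticTwist c) K p (x.2 : galH1Primary (W.quadraticTwist c) p)) :=
  rfl

include hK in
/-- **SHARP KERNEL: `Φ(η, η') = 0 ⟹ 2η = 0 ∧ 2η' = 0`** when `E(K)[p] = 0` (from the `H¹`-level
`two_nsmul_eq_zero_of_resPrimary_add_twist_eq_zero`; the tree's generic
`nsmul_eq_zero_of_comparisonMap_eq_zero` has exponent `8`). [cite: DokchitserDokchitserAnnals2010, Lemma 4.14 (proof)] -/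
theorem two_nsmul_eq_zero_of_comparisonMap_eq_zero_of_noTorsion
    (hL : ∀ P : (W.baseChange K).toAffine.Point, p • P = 0 → P = 0)
    (x : selmerGroupPInfty W p × selmerGroupPInfty (W.quadraticTwist c) p)
    (hx : comparisonMap W K hθ hc p x = 0) : 2 • x = 0 := by
  have h0 : resPrimary W K p (x.1 : galH1Primary W p) +
      hPsiK W K hθ hc p (resPrimary (W.quadraticTwist c) K p
        (x.2 : galH1Primary (W.quadraticTwist c) p)) = 0 := by
    rw [← coe_comparisonMap_apply, hx]; rfl
  obtain ⟨h1, h2⟩ := two_nsmul_eq_zero_of_resPrimary_add_twist_eq_zero W K hK.1 hθ hc p hL _ _ h0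
  refine Prod.ext (Subtype.ext ?_) (Subtype.ext ?_)
  · simpa using h1
  · simpa using h2

include hK in
/-- **The kernel of `Φ` embeds into the first factor** (and symmetrically into the second): two
kernel elements with the same `E`-component coincide, because `hPsiK ∘ res` is injective on
`H¹(ℚ, E^{(c)}[p^∞])` when `E(K)[p] = 0`. So `#ker Φ ≤ #Sel_{p^∞}(E/ℚ)[2]`.
[cite: DokchitserDokchitserAnnals2010, Lemma 4.14 (proof)] -/
theorem eq_of_comparisonMap_eq_zero_of_fst_eq
    (hL : ∀ P : (W.baseChange K).toAffine.Point, p • P = 0 → P = 0)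
    {x y : selmerGroupPInfty W p × selmerGroupPInfty (W.quadraticTwist c) p}
    (hx : comparisonMap W K hθ hc p x = 0) (hy : comparisonMap W K hθ hc p y = 0) (h : x.1 = y.1) :
    x = y := by
  have hinj := (resPrimary_twist_injective_and_range_eq_antifixed W K hK.1 hθ hc p hL).1
  have hx0 : resPrimary W K p (x.1 : galH1Primary W p) +
      hPsiK W K hθ hc p (resPrimary (W.quadraticTwist c) K p
        (x.2 : galH1Primary (W.quadraticTwist c) p)) = 0 := by
    rw [← coe_comparisonMap_apply, hx]; rfl
  have hy0 : resPrimary W K p (y.1 : galH1Primary W p) +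
      hPsiK W K hθ hc p (resPrimary (W.quadraticTwist c) K p
        (y.2 : galH1Primary (W.quadraticTwist c) p)) = 0 := by
    rw [← coe_comparisonMap_apply, hy]; rfl
  refine Prod.ext h (Subtype.ext (hinj ((hPsiK W K hθ hc p).injective ?_)))
  have e1 := eq_neg_of_add_eq_zero_right hx0
  have e2 := eq_neg_of_add_eq_zero_right hy0
  rw [e1, e2, h]

include hK in
/-- **SHARP COKERNEL: `4 · Sel_{p^∞}(E/K) ⊆ im Φ`** for `K` imaginary quadratic with `E(K)[p] = 0`:
for `s ∈ Sel_{p^∞}(E/K)`, `s + τs = res η` and `s − τs = hPsiK (res η')` (the `H¹`-level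
`exists_resPrimary_add_twist_eq_two_nsmul`), both in `Sel_{p^∞}(E/K)` (`τ`-stability), so
`2η ∈ Sel_{p^∞}(E/ℚ)`, `2η' ∈ Sel_{p^∞}(E^{(c)}/ℚ)` (`two_nsmul_mem_selmerGroupPInfty_of_res_mem`:
local degrees `≤ 2`; no archimedean factor since `K` is totally complex), and
`Φ(2η, 2η') = 2(s + τs) + 2(s − τs) = 4s`. The tree's generic `nsmul_mem_range_comparisonMap` has `8`.
[cite: DokchitserDokchitserAnnals2010, Lemma 4.14 (proof)] -/
theorem four_nsmul_mem_range_comparisonMap_of_noTorsion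
    (hL : ∀ P : (W.baseChange K).toAffine.Point, p • P = 0 → P = 0)
    (s : selmerGroupPInfty (W.baseChange K) p) :
    4 • s ∈ (comparisonMap W K hθ hc p).range := by
  have h2 := hK.1
  set τ := (isLiftOfAut_liftAut (sigmaQ K h2 hθ hc)).conjH1Primary W p with hτ
  obtain ⟨⟨η, hη⟩, ⟨η', hη'⟩, -⟩ :=
    exists_resPrimary_add_twist_eq_two_nsmul W K h2 hθ hc p hL (s : galH1Primary (W.baseChange K) p)
  have hτs : τ s ∈ selmerGroupPInfty (W.baseChange K) p :=
    conjH1Primary_mem_selmerGroupPInfty W K hK p (sigmaQ K h2 hθ hc) s.2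
  -- `res η = s + τ s ∈ Sel(E/K)` ⟹ `2η ∈ Sel(E/ℚ)`
  have hres : resPrimary W K p η ∈ selmerGroupPInfty (W.baseChange K) p := by
    rw [hη]; exact AddSubgroup.add_mem _ s.2 hτs
  have h2η : 2 • η ∈ selmerGroupPInfty W p :=
    two_nsmul_mem_selmerGroupPInfty_of_res_mem W K h2.le p (resPrimary W K p)
      (primaryH1ToH1_resPrimary W K p) hres
  -- `hPsiK (res η') = s - τ s ∈ Sel(E/K)` ⟹ `res η' ∈ Sel(E^{(c)}/K)` ⟹ `2η' ∈ Sel(E^{(c)}/ℚ)`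
  have hres' : resPrimary (W.quadraticTwist c) K p η' ∈
      selmerGroupPInfty ((W.quadraticTwist c).baseChange K) p := by
    rw [mem_selmerGroupPInfty_iff_hPsiK_mem W K hθ hc p, hη']
    exact AddSubgroup.sub_mem _ s.2 hτs
  have h2η' : 2 • η' ∈ selmerGroupPInfty (W.quadraticTwist c) p :=
    two_nsmul_mem_selmerGroupPInfty_of_res_mem (W.quadraticTwist c) K h2.le p
      (resPrimary (W.quadraticTwist c) K p) (primaryH1ToH1_resPrimary (W.quadraticTwist c) K p) hres'
  refine ⟨(⟨2 • η, h2η⟩, ⟨2 • η', h2η'⟩), Subtype.ext ?_⟩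
  rw [coe_comparisonMap_apply]
  change resPrimary W K p (2 • η) + hPsiK W K hθ hc p (resPrimary (W.quadraticTwist c) K p (2 • η')) =
    ((4 • s : selmerGroupPInfty (W.baseChange K) p) : galH1Primary (W.baseChange K) p)
  rw [map_nsmul, map_nsmul, map_nsmul, hη, hη', AddSubmonoidClass.coe_nsmul]
  rw [show (4 : ℕ) = 2 + 2 from rfl, add_nsmul]
  simp only [two_nsmul]
  abel

/-- **The habitat of Q3 (`p = 2`, `ρ̄_{E,2}` onto, `K` imaginary quadratic): kernel of `Φ` killed by
`2` (and embedded in the first factor), cokernel killed by `4`** — `E(K)[2] = 0` by the tree's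
`forall_two_nsmul_baseChange_of_hasSurjectiveModNGaloisRep_two_of_isImaginaryQuadratic`. This is the
Selmer-level shadow of «`Sel_{2^∞}(E/K)^{±}` = `Sel_{2^∞}(E/ℚ)`, `Sel_{2^∞}(E^K/ℚ)` up to the primes
ramified in `K`» (stub S8 of the kernel-status memo, evidence #9 on the item): the exponent `4` is
`2` (eigen splitting, `p612344`) × `2` (local degree at the non-split places); BSD is not proved by
this. [cite: DokchitserDokchitserAnnals2010, Lemma 4.14 (proof)]
[cite: DokchitserDokchitserMathZ2012, Theorem (1)] -/
theorem comparisonMap_two_sharp_of_habitat [W.IsElliptic] (hK : IsImaginaryQuadratic K)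
    (hρ : ∀ n : ℕ, 0 < n → W.HasSurjectiveModNGaloisRep ((2 : ℤ) ^ n)) :
    (∀ x : selmerGroupPInfty W 2 × selmerGroupPInfty (W.quadraticTwist c) 2,
        comparisonMap W K hθ hc 2 x = 0 → 2 • x = 0) ∧
      (∀ x y : selmerGroupPInfty W 2 × selmerGroupPInfty (W.quadraticTwist c) 2,
        comparisonMap W K hθ hc 2 x = 0 → comparisonMap W K hθ hc 2 y = 0 → x.1 = y.1 → x = y) ∧
      ∀ s : selmerGroupPInfty (W.baseChange K) 2, 4 • s ∈ (comparisonMap W K hθ hc 2).range := by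
  have hs : W.HasSurjectiveModNGaloisRep 2 := by simpa using hρ 1 one_pos
  have hL : ∀ P : (W.baseChange K).toAffine.Point, 2 • P = 0 → P = 0 :=
    forall_two_nsmul_baseChange_of_hasSurjectiveModNGaloisRep_two_of_isImaginaryQuadratic W hs K hK
  exact ⟨two_nsmul_eq_zero_of_comparisonMap_eq_zero_of_noTorsion W K hK hθ hc 2 hL,
    fun x y hx hy h ↦ eq_of_comparisonMap_eq_zero_of_fst_eq W K hK hθ hc 2 hL hx hy h,
    four_nsmul_mem_range_comparisonMap_of_noTorsion W K hK hθ hc 2 hL⟩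

end ImaginaryQuadratic

end Summit.BirchSwinnertonDyer.BirchSwinnertonDyer.Theorems.GenusExact.QuadInfResTwist

end
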